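import Mathlib
import HarnessLib
import Summits.ValiantsHypothesis.ValiantsHypothesis.Theses.PermanentalCones
import Literature.Computability.AlgebraicComplexity.ValiantClasses
import Literature.Computability.AlgebraicComplexity.ArithCircuitProofs
import Literature.AlgebraicGeometry.HyperbolicPolynomials.SpectrahedralShadow

/-!
# ValiantsHypothesis / PermanentalCones — `HyperbolicVPShadow`, line `birth`: the crux restricted
# to exactly-`n`-variate families with an eventual size bound still contains Netzer–Sanyal

Companion of `PermanentalConesHyperbolicVPShadowNetzerSanyal.lean` (HT ⇒ (NS) through constant
families). Here HT is weakened to families `f n ∈ ℝ[x_1, …, x_n]` with EXACTLY `n` variables at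
index `n` (no free choice `v n` of the number of variables) and with the lifted-LMI size bound
`m ≤ 2^((log₂ n + c)^c)` required only EVENTUALLY (`n ≥ n₀`); the conclusion is still

  (NS) every closed hyperbolicity cone of a real homogeneous form hyperbolic w.r.t. `e` is a
       spectrahedral shadow (Netzer–Sanyal, Math. Program. 153 (2015), p. 6 — open in general).

Proof (padding and slicing). Given `f ∈ ℝ[x_1, …, x_k]` homogeneous and hyperbolic w.r.t. `e`, the
padded family `g n := f(x_1, …, x_k) ∈ ℝ[x_1, …, x_n]` for `n ≥ k` (`MvPolynomial.rename` along
`Fin.castLE`; `g n := 1` for `n < k`) is a `VP_ℂ` family (complexity and degree bounded by those of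
`f`, `n` variables), each member is homogeneous, and `g n` is hyperbolic w.r.t. the padded direction
`e' n := (e, 0, …, 0)`. The restricted HT gives a lifted-LMI description of the closed cone of
`g n` for `n := max n₀ k`, and the closed cone of `f` is its preimage under the coordinate
embedding `L : ℝ^k → ℝ^n` (a linear map), hence a spectrahedral shadow (compose the pencil with
`L × id`). The size bound of HT is not used.
-/

-- `<Problem> = <Summit>` for this single-conjunct summit (lakefile sets the same option tree-wide).
set_option linter.dupNamespace false

namespace Summit.ValiantsHypothesis.ValiantsHypothesis.Theorems

open MvPolynomial Literature.Computability.AlgebraicComplexity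
open Literature.AlgebraicGeometry.HyperbolicPolynomials

/-- Renaming variables keeps hyperbolicity, in any direction `e'` lifting the old one
(`e' ∘ φ = e`): `(rename φ f)(x + z e') = f(x ∘ φ + z (e' ∘ φ))`. [folklore] -/
theorem permanentalCones_isHyperbolic_rename {σ τ : Type*} (φ : σ → τ) {f : MvPolynomial σ ℝ}
    {e' : τ → ℝ} (h : IsHyperbolic f (e' ∘ φ)) : IsHyperbolic (rename φ f) e' := by
  refine ⟨by rw [eval_rename]; exact h.1, fun x z hz => h.2 (x ∘ φ) z ?_⟩
  rw [map_rename, eval_rename] at hz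
  exact hz

/-- The closed hyperbolicity cone of a renamed polynomial is the preimage of the original cone
under the coordinate projection `x ↦ x ∘ φ`. [folklore] -/
theorem permanentalCones_mem_hyperbolicityCone_rename {σ τ : Type*} (φ : σ → τ)
    (f : MvPolynomial σ ℝ) (e' x : τ → ℝ) :
    x ∈ hyperbolicityCone (rename φ f) e' ↔ x ∘ φ ∈ hyperbolicityCone f (e' ∘ φ) := by
  simp only [mem_hyperbolicityCone_iff, eval_rename]
  exact Iff.rfl

/-- The padded family `g n := f(x_1, …, x_k) ∈ ℝ[x_1, …, x_n]` (`n ≥ k`; `g n := 1` for `n < k`)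
has a `VP_ℂ` complexification: `n` variables, degree and complexity bounded by those of `f_ℂ`
(renaming does not increase either). [folklore] -/
theorem permanentalCones_isVPFamily_pad (k : ℕ) (f : MvPolynomial (Fin k) ℝ) :
    IsVPFamily (σ := fun n => Fin n) fun n => MvPolynomial.map (algebraMap ℝ ℂ)
      (if h : k ≤ n then rename (Fin.castLE h) f else (1 : MvPolynomial (Fin n) ℝ)) := by
  refine ⟨⟨⟨1, fun n => by simp⟩,
    IsPBounded.mono (IsPBounded.const (MvPolynomial.map (algebraMap ℝ ℂ) f).totalDegree)
      fun n => ?_⟩,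
    IsPBounded.mono (IsPBounded.const (complexity (MvPolynomial.map (algebraMap ℝ ℂ) f)))
      fun n => ?_⟩
  · dsimp only
    split_ifs with h
    · rw [map_rename]
      exact totalDegree_rename_le _ _
    · simp
  · dsimp only
    split_ifs with h
    · rw [map_rename]
      exact complexity_rename_le_holds' _ _
    · rw [map_one, ← C_1, complexity_C_holds]
      exact Nat.zero_le _

/-- Every member of the padded family is homogeneous (of degree `deg f`, resp. `0`). [folklore] -/
theorem permanentalCones_isHomogeneous_pad {k : ℕ} {f : MvPolynomial (Fin k) ℝ} {d : ℕ}
    (hf : f.IsHomogeneous d) (n : ℕ) :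
    ∃ d' : ℕ, (if h : k ≤ n then rename (Fin.castLE h) f
      else (1 : MvPolynomial (Fin n) ℝ)).IsHomogeneous d' := by
  by_cases h : k ≤ n
  · exact ⟨d, by rw [dif_pos h]; exact hf.rename_isHomogeneous⟩
  · exact ⟨0, by rw [dif_neg h]; exact isHomogeneous_one _ _⟩

/-- Every member of the padded family is hyperbolic w.r.t. the padded direction
`e' n = (e, 0, …, 0)`. [folklore] -/
theorem permanentalCones_isHyperbolic_pad {k : ℕ} {f : MvPolynomial (Fin k) ℝ} {e : Fin k → ℝ}
    (he : IsHyperbolic f e) (n : ℕ) :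
    IsHyperbolic (if h : k ≤ n then rename (Fin.castLE h) f else (1 : MvPolynomial (Fin n) ℝ))
      (fun j : Fin n => if h : (j : ℕ) < k then e ⟨j, h⟩ else 0) := by
  by_cases h : k ≤ n
  · rw [dif_pos h]
    refine permanentalCones_isHyperbolic_rename _ ?_
    have hcomp : (fun j : Fin n => if h : (j : ℕ) < k then e ⟨j, h⟩ else 0) ∘ Fin.castLE h = e :=
      funext fun i => by simp
    rwa [hcomp]
  · rw [dif_neg h]
    exact ⟨by simp, fun x z hz => by simp at hz⟩

/-- **Restricted HT ⇒ (NS).** Even restricted to families with exactly `n` variables at index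
`n` and with the size bound required only for `n ≥ n₀`, the crux `HyperbolicVPShadow` implies
that every closed hyperbolicity cone of a real homogeneous hyperbolic form is a spectrahedral
shadow (the Netzer–Sanyal conjecture, open in general): pad `f` to `n = max n₀ k` variables and
slice the lifted-LMI description back along the coordinate embedding `ℝ^k → ℝ^n`. [folklore] -/
theorem permanentalCones_netzerSanyal_of_hyperbolicVPShadow_exactVars :
    (∀ (f : ∀ n : ℕ, MvPolynomial (Fin n) ℝ) (e : ∀ n : ℕ, Fin n → ℝ),
      Literature.Computability.AlgebraicComplexity.IsVPFamily
        (fun n => MvPolynomial.map (algebraMap ℝ ℂ) (f n)) →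
      (∀ n, ∃ d : ℕ, (f n).IsHomogeneous d) →
      (∀ n, MvPolynomial.eval (e n) (f n) ≠ 0 ∧ ∀ (x : Fin n → ℝ) (z : ℂ),
        MvPolynomial.eval (fun j => (x j : ℂ) + z * (e n j : ℂ))
          (MvPolynomial.map (algebraMap ℝ ℂ) (f n)) = 0 → z.im = 0) →
      ∃ c n₀ : ℕ, ∀ n : ℕ, n₀ ≤ n → ∃ m ≤ 2 ^ ((Nat.log 2 n + c) ^ c),
        ∃ (p : ℕ) (A : (Fin n → ℝ) × (Fin p → ℝ) →ₗ[ℝ] Matrix (Fin m) (Fin m) ℝ)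
          (B : Matrix (Fin m) (Fin m) ℝ), ∀ x : Fin n → ℝ,
          (∀ τ : ℝ, 0 < τ → MvPolynomial.eval (x + τ • e n) (f n) ≠ 0) ↔
            ∃ y : Fin p → ℝ, (A (x, y) + B).PosSemidef) →
      ∀ (k : ℕ) (f : MvPolynomial (Fin k) ℝ) (e : Fin k → ℝ) (d : ℕ), f.IsHomogeneous d →
        Literature.AlgebraicGeometry.HyperbolicPolynomials.IsHyperbolic f e →
        Literature.AlgebraicGeometry.HyperbolicPolynomials.IsSpectrahedralShadow
          (Literature.AlgebraicGeometry.HyperbolicPolynomials.hyperbolicityCone f e) := by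
  intro hHT k f e d hf he
  -- apply the restricted HT to the padded family and take the member `n := max n₀ k`
  obtain ⟨c, n₀, hc⟩ := hHT (fun n => if h : k ≤ n then rename (Fin.castLE h) f else 1)
    (fun n j => if h : (j : ℕ) < k then e ⟨j, h⟩ else 0) (permanentalCones_isVPFamily_pad k f)
    (permanentalCones_isHomogeneous_pad hf) (fun n => permanentalCones_isHyperbolic_pad he n)
  have hk : k ≤ max n₀ k := le_max_right _ _
  obtain ⟨m, -, p, A, B, hrep⟩ := hc (max n₀ k) (le_max_left _ _)
  simp only [dif_pos hk] at hrep
  -- the coordinate embedding `ℝ^k → ℝ^n` (zero on the padded coordinates)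
  let L : (Fin k → ℝ) →ₗ[ℝ] (Fin (max n₀ k) → ℝ) :=
    { toFun := fun u j => if h : (j : ℕ) < k then u ⟨j, h⟩ else 0
      map_add' := fun u v => by
        funext j
        dsimp only [Pi.add_apply]
        split_ifs <;> simp
      map_smul' := fun a u => by
        funext j
        dsimp only [Pi.smul_apply, RingHom.id_apply, smul_eq_mul]
        split_ifs <;> simp }
  have hL : ∀ u, (L u) ∘ Fin.castLE hk = u := fun u => funext fun i => by simp [L]
  have he' : (fun j : Fin (max n₀ k) => if h : (j : ℕ) < k then e ⟨j, h⟩ else 0) ∘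
      Fin.castLE hk = e := funext fun i => by simp
  refine ⟨m, p, A ∘ₗ (L.prodMap LinearMap.id), B, fun u => ?_⟩
  have key : u ∈ hyperbolicityCone f e ↔ L u ∈ hyperbolicityCone (rename (Fin.castLE hk) f)
      (fun j : Fin (max n₀ k) => if h : (j : ℕ) < k then e ⟨j, h⟩ else 0) := by
    rw [permanentalCones_mem_hyperbolicityCone_rename, hL, he']
  rw [key, mem_hyperbolicityCone_iff, hrep]
  simp only [LinearMap.comp_apply, LinearMap.prodMap_apply, LinearMap.id_apply]

end Summit.ValiantsHypothesis.ValiantsHypothesis.Theorems
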